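import Literature.Probability.Percolation.IsoradialArmExtension
import Literature.Probability.Percolation.IsoradialTranslation
import HarnessLib

/-!
# Arm events of isoradial graphs under a bounded change of centre (GM 2014, §3 and §8.4, last
paragraph), and radii rescaled by arbitrary factors (Prop. 8.2 (a)–(b) iterated, `k = 1`)

Proofs-only companion (D-0026: theorems only, no new definition, no new named fact) of
`Literature.Probability.Percolation.IsoradialArmComparability` — the named fact
`GrimmettManolescu2014_armComparability_one_two` (`T`: Grimmett–Manolescu, *Bond percolation on
isoradial graphs*, PTRF 159 (2014) 273–327 = arXiv:1204.0505, §8.1 Prop. (exp_transport) with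
§8.2 Prop. (exp_equiv), `k ∈ {1, 2}`) — continuing `IsoradialArmComparabilityProofs`
(monotonicity in the radii, glue), `IsoradialCrossingPaths` (gluing toolkit) and
`IsoradialArmExtension` (Prop. (exp_equiv) (a), (b) for `k = 1` under the box-crossing bounds).

**What is formalized here.** The printed Prop. (exp_transport) is uniform in the centre:
"for `N ≥ N₀`, `n ≥ c₀N₀`, `G ∈ 𝒢(ε, I)`, and any vertex `u` of `G^◇`". Its proof (§8.3–8.4)
treats first the vertex `u` adjacent to the two distinguished tracks `s₀`, `t₀` of a square grid
and ends (§8.4, after Lemma (exp_transport2)) with: "By the square-grid property, any vertex is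
within bounded distance of one of the tracks `(s_j : j ∈ ℤ)`. This allows us to extend the
conclusion to arm events centred at any vertex." In the tree the arm events
`RhombicEmbedding.embArmEvent κ r R` (`IsoradialPercolation`) are centred at the origin of `ℂ`
and a change of centre by `-a` is the passage from `emb` to the translated embedding
`emb.translate a` (`IsoradialTranslation`, where the sibling fact on the *alternating* events
`embAltArmEvent` received the corresponding lemma `embAltArmEvent_inter_subset_translate`). This
file supplies the step for the vertex-disjoint events `embArmEvent` of `T`, for **every** colour
sequence `κ`, and — for one arm, where Prop. (exp_equiv) (a), (b) is available in the tree
(`IsoradialArmExtension`) — the resulting comparability of the arm probabilities at nearby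
centres:

* `RhombicEmbedding.embArmEvent_inter_subset_translate` — for `‖a‖_∞ ≤ d` and `r + 2d ≤ R`,
  `A_κ(r, R)[emb] ∩ {ω ⊆ E(G)} ⊆ A_κ(r + d, R - d)[emb.translate a]`: every arm of the wide
  annulus around `0` contains a window (`exists_walk_window`) crossing the narrow annulus around
  `-a`; windows of vertex-disjoint walks are vertex-disjoint. In probability (the canonical
  measure is translation invariant, `isoradialPercolation_translate`):
  `RhombicEmbedding.embArmProb_le_translate` (`P[A_κ(r, R), centre 0] ≤ P[A_κ(r+d, R-d), centre -a]`)
  and `RhombicEmbedding.translate_embArmProb_le` (the same with the roles exchanged). This is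
  the sandwich `A^u(N - d, n + d) ⊆ A^0(N, n) ⊆ A^u(N + d, n - d)`, `‖u‖_∞ ≤ d`, of GM §3 /
  §8.4 for the events of `T` (both `k = 1` and `k = 2`, indeed all `κ`).
* `boxCrossingBounds_translate` — the box-crossing bounds `BoxCrossingBounds μ z ρ c n₀`
  (uniform in the translation `w`) are invariant under translating the drawing.
* One arm under the box-crossing bounds at aspect ratio `4` (`BoxCrossingBounds P_G z 4 c n₀`,
  the input delivered on `𝒢(ε, I)` by the unproved fact `gm_boxCrossingBounds_uniform`, GM
  Thm 3.1 / (3.1)): `embArmProb_shrink_le` — shrinking the annulus by `d ≤ N` on both sides costs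
  at most the factor `c⁻¹⁵` (`P[A₁(N + d, n - d)] ≤ c⁻¹⁵ P[A₁(N, n)]`, `N ≥ n₀ ⊔ 2`, `n ≥ 5N`; one
  inner and one outer doubling of `IsoradialArmExtension`); hence
  **`embArmProb_translate_le`, `embArmProb_le_translate_mul`: for `‖a‖_∞ ≤ d ≤ N`, `N ≥ n₀ ⊔ 2`,
  `n ≥ 5N`, the one-arm probabilities centred at `0` and at `-a` are within the factor `c⁻¹⁵` of
  each other** — the last paragraph of GM §8.4 for `k = 1`, quantitatively, conditional on BXP.
* `embArmProb_mul_inner_le`, `embArmProb_le_mul_outer` — Prop. (exp_equiv) (a), (b) for `k = 1`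
  iterated to an arbitrary integer factor `m ≤ 2ᵏ` of the radii (the shape
  "`P[A_k(c_d N, c_d⁻¹ n)] ≤ c₄ P[A_k(N, n)]` by (exp_equiv_a) and (exp_equiv_b), iterated" of
  §8.3–8.4), from the dyadic iterations `embArmProb_pow_two_inner_le`,
  `embArmProb_le_pow_two_outer` and monotonicity.
* On the class `𝒢(ε, I)`, conditional on `gm_boxCrossingBounds_uniform`:
  `oneArm_recentre_of_gm_boxCrossingBounds_uniform` — for `ε > 0`, `I`, `d` there are `C > 0`,
  `N₀` such that for every `G ∈ 𝒢(ε, I)` (vertex type in `Type`), every `a` with `‖a‖_∞ ≤ d`,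
  all `N ≥ N₀`, `n ≥ 5N`: `P_G[A₁(N, n), centre 0] ≤ C · P_G[A₁(N, n), centre -a]` and
  conversely (`C = c(ε, I, 4)⁻¹⁵`).

Not here (the deep, still missing parts of the discharge of `T`, see the module docstring of
`IsoradialArmComparabilityProofs`): the box-crossing Theorem 3.1 itself
(`gm_boxCrossingBounds_uniform`), the star–triangle transport of arm events between graphs of
`𝒢(ε, I)` (§8.3 Lemma (exp_transport1), §8.4 Lemma (exp_transport2)), Prop. (exp_equiv) for
`k = 2` and part (c) (separation theorem, §8.5).

## References

* G. R. Grimmett, I. Manolescu, *Bond percolation on isoradial graphs: criticality and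
  universality*, PTRF 159 (2014) 273–327, arXiv:1204.0505: §3 (annuli `𝒜^u(N, n)` and events
  `A_σ^u(N, n)` "centred at `u`"), §8.1 Prop. (exp_transport) ("any vertex `u` of `G^◇`"),
  §8.2 Prop. (exp_equiv) (a), (b), §8.3 (iteration of (a), (b)), §8.4 last paragraph (change of
  centre by a bounded distance).
-/

noncomputable section

open MeasureTheory

namespace Literature.Probability.Percolation

open LatticeModels Percolation IsoradialArmComparability

/-! ### §1 The vertex-disjoint arm events under a bounded change of centre (every `κ`) -/

section Translate

variable {V F : Type*} {G : SimpleGraph V} (emb : RhombicEmbedding G F)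

/-- **The arm event `A_κ` under a bounded change of centre** (up to configurations using
non-edges of `G`): if `‖a‖_∞ ≤ d` and `r + 2d ≤ R`, then
`A_κ(r, R)[emb] ∩ {ω ⊆ E(G)} ⊆ A_κ(r + d, R - d)[emb.translate a]` for every colour sequence `κ`.
Each primal arm, an open walk from `{‖z‖_∞ ≤ r}` to `{R ≤ ‖z‖_∞}` inside
`{r - 2 ≤ ‖z‖_∞ ≤ R + 2}`, starts in `{‖z + a‖_∞ ≤ r + d}` and ends in `{R - d ≤ ‖z + a‖_∞}`, so it
contains a window (`exists_walk_window` for the height `‖z · + a‖_∞`, which moves by at most `2`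
along open edges of an isoradial graph) from the former set to the latter inside
`{r + d - 2 ≤ ‖z + a‖_∞ ≤ R - d + 2}`; dual arms likewise (the dual open graph is unchanged,
`dualOpenGraph_translate`); windows of pairwise vertex-disjoint walks are pairwise
vertex-disjoint. This is the inclusion `A^0(N, n) ⊆ A^u(N + d, n - d)`, `‖u‖_∞ ≤ d`, between the
events centred at nearby points (Grimmett–Manolescu 2014, §3, events "centred at `u`"; §8.4,
last paragraph: "any vertex is within bounded distance of one of the tracks … This allows us to
extend the conclusion to arm events centred at any vertex").
[cite: GrimmettManolescu2014Isoradial, §3 (A_σ^u(N,n)) and §8.4 (last paragraph)] -/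
theorem _root_.Literature.Probability.LatticeModels.RhombicEmbedding.embArmEvent_inter_subset_translate
    (hiso : emb.IsIsoradial) {k : ℕ} (κ : Fin k → Bool) {a : ℂ} {d : ℕ} (ha : a.boxNorm ≤ d)
    {r R : ℕ} (hrR : r + 2 * d ≤ R) :
    emb.embArmEvent κ r R ∩ {ω | ω ⊆ G.edgeSet} ⊆
      (emb.translate a).embArmEvent κ (r + d) (R - d) := by
  rintro ω ⟨hω, hgood⟩
  have hgood' : ω ⊆ G.edgeSet := hgood
  have hiso' : (emb.translate a).IsIsoradial := hiso.translate
  simp only [RhombicEmbedding.embArmEvent, Set.mem_setOf_eq] at hω ⊢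
  obtain ⟨x, y, w, f, g, w', hprim, hdual, hdisjP, hdisjD⟩ := hω
  have hdR : d ≤ R := by omega
  have hdRℝ : ((R - d : ℕ) : ℝ) = R - d := Nat.cast_sub hdR
  have hrdℝ : ((r + d : ℕ) : ℝ) = r + d := by push_cast; ring
  have hst : (r : ℝ) + d ≤ R - d := by
    have : ((r + 2 * d : ℕ) : ℝ) ≤ R := by exact_mod_cast hrR
    push_cast at this; linarith
  -- primal arms: a window of each, for the height `‖z · + a‖_∞`
  have keyP : ∀ j, ∃ (x' y' : V) (q : (openGraph ω).Walk x' y'),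
      (∀ v ∈ q.support, v ∈ (w j).support) ∧
      (κ j = true → ((emb.translate a).z x').boxNorm ≤ (r : ℝ) + d ∧
        (R : ℝ) - d ≤ ((emb.translate a).z y').boxNorm ∧
        ∀ v ∈ q.support, (r : ℝ) + d - 2 ≤ ((emb.translate a).z v).boxNorm ∧
          ((emb.translate a).z v).boxNorm ≤ (R : ℝ) - d + 2) := by
    intro j
    by_cases hj : κ j = true
    · obtain ⟨hx, hy, -⟩ := hprim j hj
      have hu : ((emb.translate a).z (x j)).boxNorm ≤ r + d := by
        have := IsoradialCriticality.boxNorm_add_le (emb.z (x j)) a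
        simp only [RhombicEmbedding.translate_z]; linarith
      have hv : (R : ℝ) - d ≤ ((emb.translate a).z (y j)).boxNorm := by
        have := boxNorm_sub_le_boxNorm_add (emb.z (y j)) a
        simp only [RhombicEmbedding.translate_z]; linarith
      obtain ⟨x', y', q, -, hx', hy', hqw, hqf⟩ := exists_walk_window
        (fun v => ((emb.translate a).z v).boxNorm) hst
        (fun u v huv => (emb.translate a).boxNorm_z_le_of_openGraph_adj hiso' hgood' huv) (w j)
        hu hv
      exact ⟨x', y', q, hqw, fun _ => ⟨hx', hy', hqf⟩⟩
    · exact ⟨x j, y j, w j, fun v hv => hv, fun h => absurd h hj⟩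
  choose x' y' q hq using keyP
  -- dual arms, likewise, in the (unchanged) dual open graph
  have keyD : ∀ j, ∃ (f' g' : F) (q' : (emb.dualOpenGraph ω).Walk f' g'),
      (∀ v ∈ q'.support, v ∈ (w' j).support) ∧
      (κ j = false → ((emb.translate a).c f').boxNorm ≤ (r : ℝ) + d ∧
        (R : ℝ) - d ≤ ((emb.translate a).c g').boxNorm ∧
        ∀ v ∈ q'.support, (r : ℝ) + d - 2 ≤ ((emb.translate a).c v).boxNorm ∧
          ((emb.translate a).c v).boxNorm ≤ (R : ℝ) - d + 2) := by
    intro j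
    by_cases hj : κ j = false
    · obtain ⟨hf, hg, -⟩ := hdual j hj
      have hu : ((emb.translate a).c (f j)).boxNorm ≤ r + d := by
        have := IsoradialCriticality.boxNorm_add_le (emb.c (f j)) a
        simp only [RhombicEmbedding.translate_c]; linarith
      have hv : (R : ℝ) - d ≤ ((emb.translate a).c (g j)).boxNorm := by
        have := boxNorm_sub_le_boxNorm_add (emb.c (g j)) a
        simp only [RhombicEmbedding.translate_c]; linarith
      obtain ⟨f', g', q', -, hf', hg', hqw, hqf⟩ := exists_walk_window
        (fun v => ((emb.translate a).c v).boxNorm) hst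
        (fun u v huv => (emb.translate a).boxNorm_c_le_of_dualOpenGraph_adj hiso'
          (by rw [RhombicEmbedding.dualOpenGraph_translate]; exact huv)) (w' j) hu hv
      exact ⟨f', g', q', hqw, fun _ => ⟨hf', hg', hqf⟩⟩
    · exact ⟨f j, g j, w' j, fun v hv => hv, fun h => absurd h hj⟩
  choose f' g' q' hq' using keyD
  refine ⟨x', y', q, f', g', fun j => ?_, fun j hj => ?_, fun j hj => ?_, fun i j hij hi hj => ?_,
    fun i j hij hi hj => ?_⟩
  · rw [RhombicEmbedding.dualOpenGraph_translate]; exact q' j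
  · obtain ⟨hx', hy', hsupp⟩ := (hq j).2 hj
    refine ⟨by rw [hrdℝ]; exact hx', by rw [hdRℝ]; exact hy', fun v hv => ?_⟩
    rw [Set.mem_Icc, hrdℝ, hdRℝ]
    exact hsupp v hv
  · obtain ⟨hf', hg', hsupp⟩ := (hq' j).2 hj
    refine ⟨by rw [hrdℝ]; exact hf', by rw [hdRℝ]; exact hg', fun v hv => ?_⟩
    rw [Set.mem_Icc, hrdℝ, hdRℝ]
    exact hsupp v hv
  · exact (hdisjP hij hi hj).mono (fun v hv => (hq i).1 v hv) (fun v hv => (hq j).1 v hv)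
  · exact (hdisjD hij hi hj).mono (fun v hv => (hq' i).1 v hv) (fun v hv => (hq' j).1 v hv)

/-- **In probability: moving the centre by `‖a‖_∞ ≤ d` costs a change of radii by `d`**, for
every colour sequence: `P_G[A_κ(r, R), centre 0] ≤ P_G[A_κ(r + d, R - d), centre -a]` for
`r + 2d ≤ R` (the canonical measure is the same for `emb` and `emb.translate a`,
`isoradialPercolation_translate`; configurations using non-edges are null).
[cite: GrimmettManolescu2014Isoradial, §3 (A_σ^u(N,n)); §8.1 Prop. 8.1 (uniform in u); §8.4 (last paragraph)] -/
theorem _root_.Literature.Probability.LatticeModels.RhombicEmbedding.embArmProb_le_translate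
    [Countable V] (hiso : emb.IsIsoradial) {k : ℕ} (κ : Fin k → Bool) {a : ℂ} {d : ℕ}
    (ha : a.boxNorm ≤ d) {r R : ℕ} (hrR : r + 2 * d ≤ R) :
    emb.embArmProb κ r R ≤ (emb.translate a).embArmProb κ (r + d) (R - d) := by
  simp only [RhombicEmbedding.embArmProb, RhombicEmbedding.isoradialPercolation_translate]
  exact emb.real_le_real_of_inter_subset (emb.embArmEvent_inter_subset_translate hiso κ ha hrR)

/-- **The converse sandwich**: `P_G[A_κ(r, R), centre -a] ≤ P_G[A_κ(r + d, R - d), centre 0]` for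
`‖a‖_∞ ≤ d`, `r + 2d ≤ R` (the previous inequality for `emb.translate a` and `-a`).
[cite: GrimmettManolescu2014Isoradial, §3 (A_σ^u(N,n)); §8.1 Prop. 8.1 (uniform in u); §8.4 (last paragraph)] -/
theorem _root_.Literature.Probability.LatticeModels.RhombicEmbedding.translate_embArmProb_le
    [Countable V] (hiso : emb.IsIsoradial) {k : ℕ} (κ : Fin k → Bool) {a : ℂ} {d : ℕ}
    (ha : a.boxNorm ≤ d) {r R : ℕ} (hrR : r + 2 * d ≤ R) :
    (emb.translate a).embArmProb κ r R ≤ emb.embArmProb κ (r + d) (R - d) := by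
  have ha' : (-a).boxNorm ≤ d := by rwa [IsoradialCriticality.boxNorm_neg]
  have h := (emb.translate a).embArmProb_le_translate hiso.translate κ ha' hrR
  rwa [RhombicEmbedding.translate_translate_neg] at h

/-- **The box-crossing bounds are invariant under translation of the drawing**: they quantify
over all translations `w` of the rectangles, and `(z + a) - w = z - (w - a)`.
[cite: GrimmettManolescu2014Isoradial, §2.3 (BXP(δ): all translates of the boxes)] -/
theorem boxCrossingBounds_translate {μ : Measure (BondConfig V)} {ρ c : ℝ} {n₀ : ℕ}
    (h : BoxCrossingBounds μ emb.z ρ c n₀) (a : ℂ) :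
    BoxCrossingBounds μ (emb.translate a).z ρ c n₀ := by
  intro n hn w
  have key : (fun v => (emb.translate a).z v - w) = fun v => emb.z v - (w - a) := by
    funext v; simp only [RhombicEmbedding.translate_z]; ring
  rw [key]
  exact h n hn (w - a)

end Translate

/-! ### §2 One arm under the box-crossing bounds: shrinking the annulus, nearby centres,
arbitrary rescaling factors -/

namespace IsoradialArmRecentring

open IsoradialArmExtension

variable {V F : Type*} {G : SimpleGraph V} (emb : RhombicEmbedding G F)

/-- **Shrinking the annulus by `d` on both sides costs at most `c⁻¹⁵`** (one arm, under the
box-crossing bounds at aspect ratio `4` with constant `c > 0` beyond scale `n₀`): for `d ≤ N`,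
`N ≥ n₀ ⊔ 2` and `n ≥ 5N`, `P_G[A₁(N + d, n - d)] ≤ c⁻¹⁵ · P_G[A₁(N, n)]` — the chain
`P[A₁(N+d, n-d)] ≤ P[A₁(2N, n-d)] ≤ c⁻⁵ P[A₁(N, n-d)] ≤ c⁻¹⁵ P[A₁(N, 2(n-d))] ≤ c⁻¹⁵ P[A₁(N, n)]`
(monotonicity in the inner radius, Prop. (exp_equiv) (b) then (a) for `k = 1`
(`embArmProb_double_inner_le`, `embArmProb_le_double_outer`), antitonicity in the outer radius).
This is how "the change of radii is absorbed by Prop. (exp_equiv)" when the centre is moved.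
[cite: GrimmettManolescu2014Isoradial, §8.2 Prop. (exp_equiv) (a)–(b) (k = 1); §8.4 (last paragraph)] -/
theorem embArmProb_shrink_le [Nonempty F] [Countable V] [DecidableEq V]
    (hiso : emb.IsIsoradial) (hrh : emb.IsRhombicTiling) {c : ℝ} (hc : 0 < c) {n₀ : ℕ}
    (hbxp : BoxCrossingBounds emb.isoradialPercolation emb.z 4 c n₀) {N n d : ℕ} (hn₀ : n₀ ≤ N)
    (hN : 2 ≤ N) (hdN : d ≤ N) (hn : 5 * N ≤ n) :
    emb.embArmProb oneArmColour (N + d) (n - d) ≤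
      (c ^ 15)⁻¹ * emb.embArmProb oneArmColour N n := by
  have hc5 : 0 < (c ^ 5)⁻¹ := by positivity
  have hc10 : 0 < (c ^ 10)⁻¹ := by positivity
  -- `P[A₁(N + d, n - d)] ≤ P[A₁(2N, n - d)]`
  have h1 : emb.embArmProb oneArmColour (N + d) (n - d) ≤
      emb.embArmProb oneArmColour (2 * N) (n - d) :=
    emb.embArmProb_inner_mono hiso oneArmColour (by omega) (by omega)
  -- `P[A₁(2N, n - d)] ≤ c⁻⁵ P[A₁(N, n - d)]`
  have h2 : emb.embArmProb oneArmColour (2 * N) (n - d) ≤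
      (c ^ 5)⁻¹ * emb.embArmProb oneArmColour N (n - d) :=
    embArmProb_double_inner_le emb hiso hrh hc hbxp hn₀ hN (by omega)
  -- `P[A₁(N, n - d)] ≤ c⁻¹⁰ P[A₁(N, 2(n - d))]`
  have h3 : emb.embArmProb oneArmColour N (n - d) ≤
      (c ^ 10)⁻¹ * emb.embArmProb oneArmColour N (2 * (n - d)) :=
    embArmProb_le_double_outer emb hiso hrh hc hbxp hn₀ hN (by omega)
  -- `P[A₁(N, 2(n - d))] ≤ P[A₁(N, n)]`
  have h4 : emb.embArmProb oneArmColour N (2 * (n - d)) ≤ emb.embArmProb oneArmColour N n :=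
    emb.embArmProb_outer_anti hiso oneArmColour (by omega) (by omega)
  calc emb.embArmProb oneArmColour (N + d) (n - d)
      ≤ emb.embArmProb oneArmColour (2 * N) (n - d) := h1
    _ ≤ (c ^ 5)⁻¹ * emb.embArmProb oneArmColour N (n - d) := h2
    _ ≤ (c ^ 5)⁻¹ * ((c ^ 10)⁻¹ * emb.embArmProb oneArmColour N (2 * (n - d))) := by gcongr
    _ ≤ (c ^ 5)⁻¹ * ((c ^ 10)⁻¹ * emb.embArmProb oneArmColour N n) := by gcongr
    _ = (c ^ 15)⁻¹ * emb.embArmProb oneArmColour N n := by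
        rw [← mul_assoc, ← mul_inv, ← pow_add]

/-- **Nearby centres, one arm, first direction**: under the box-crossing bounds at aspect ratio
`4` (constant `c > 0`, scale `n₀`), for `‖a‖_∞ ≤ d ≤ N`, `N ≥ n₀ ⊔ 2`, `n ≥ 5N`:
`P_G[A₁(N, n), centre -a] ≤ c⁻¹⁵ · P_G[A₁(N, n), centre 0]`
(`translate_embArmProb_le` followed by `embArmProb_shrink_le`). The last paragraph of GM §8.4
("extend the conclusion to arm events centred at any vertex") for `k = 1`, quantitatively,
conditional on the box-crossing property.
[cite: GrimmettManolescu2014Isoradial, §8.4 (last paragraph); §8.2 Prop. (exp_equiv) (a)–(b) (k = 1)] -/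
theorem embArmProb_translate_le [Nonempty F] [Countable V] [DecidableEq V]
    (hiso : emb.IsIsoradial) (hrh : emb.IsRhombicTiling) {c : ℝ} (hc : 0 < c) {n₀ : ℕ}
    (hbxp : BoxCrossingBounds emb.isoradialPercolation emb.z 4 c n₀) {a : ℂ} {d : ℕ}
    (ha : a.boxNorm ≤ d) {N n : ℕ} (hn₀ : n₀ ≤ N) (hN : 2 ≤ N) (hdN : d ≤ N) (hn : 5 * N ≤ n) :
    (emb.translate a).embArmProb oneArmColour N n ≤
      (c ^ 15)⁻¹ * emb.embArmProb oneArmColour N n :=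
  (emb.translate_embArmProb_le hiso oneArmColour ha (by omega)).trans
    (embArmProb_shrink_le emb hiso hrh hc hbxp hn₀ hN hdN hn)

/-- **Nearby centres, one arm, second direction**: under the same hypotheses,
`P_G[A₁(N, n), centre 0] ≤ c⁻¹⁵ · P_G[A₁(N, n), centre -a]` — the previous theorem for the
translated embedding `emb.translate a` (isoradial, a rhombic tiling, with the same canonical
measure and, by `boxCrossingBounds_translate`, the same box-crossing bounds) and `-a`.
[cite: GrimmettManolescu2014Isoradial, §8.4 (last paragraph); §8.2 Prop. (exp_equiv) (a)–(b) (k = 1)] -/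
theorem embArmProb_le_translate_mul [Nonempty F] [Countable V] [DecidableEq V]
    (hiso : emb.IsIsoradial) (hrh : emb.IsRhombicTiling) {c : ℝ} (hc : 0 < c) {n₀ : ℕ}
    (hbxp : BoxCrossingBounds emb.isoradialPercolation emb.z 4 c n₀) {a : ℂ} {d : ℕ}
    (ha : a.boxNorm ≤ d) {N n : ℕ} (hn₀ : n₀ ≤ N) (hN : 2 ≤ N) (hdN : d ≤ N) (hn : 5 * N ≤ n) :
    emb.embArmProb oneArmColour N n ≤
      (c ^ 15)⁻¹ * (emb.translate a).embArmProb oneArmColour N n := by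
  have ha' : (-a).boxNorm ≤ d := by rwa [IsoradialCriticality.boxNorm_neg]
  have hbxp' : BoxCrossingBounds (emb.translate a).isoradialPercolation (emb.translate a).z 4 c n₀ := by
    rw [RhombicEmbedding.isoradialPercolation_translate]
    exact boxCrossingBounds_translate emb hbxp a
  have h := embArmProb_translate_le (emb.translate a) hiso.translate hrh.translate hc hbxp' ha'
    hn₀ hN hdN hn
  rwa [RhombicEmbedding.translate_translate_neg] at h

/-- **Prop. (exp_equiv) (b) for one arm, iterated to an arbitrary factor**: for `m ≤ 2ᵏ`,
`N ≥ n₀ ⊔ 2` and `2ᵏ⁺¹ N ≤ n`, `P_G[A₁(m N, n)] ≤ c⁻⁵ᵏ · P_G[A₁(N, n)]` (monotonicity in the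
inner radius up to `2ᵏ N`, then `embArmProb_pow_two_inner_le`) — the shape
"`P[A_k(c_d N, ·)] ≤ c P[A_k(N, ·)]` … by (exp_equiv_b), iterated" of GM §8.3.
[cite: GrimmettManolescu2014Isoradial, §8.2 Prop. (exp_equiv) (b) iterated, §8.3] -/
theorem embArmProb_mul_inner_le [Nonempty F] [Countable V] [DecidableEq V]
    (hiso : emb.IsIsoradial) (hrh : emb.IsRhombicTiling) {c : ℝ} (hc : 0 < c) {n₀ : ℕ}
    (hbxp : BoxCrossingBounds emb.isoradialPercolation emb.z 4 c n₀) {N n : ℕ} (hn₀ : n₀ ≤ N)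
    (hN : 2 ≤ N) {m k : ℕ} (hm : m ≤ 2 ^ k) (hk : 2 ^ (k + 1) * N ≤ n) :
    emb.embArmProb oneArmColour (m * N) n ≤
      ((c ^ 5)⁻¹) ^ k * emb.embArmProb oneArmColour N n := by
  rcases Nat.eq_zero_or_pos m with rfl | hm0
  · -- `m = 0`: `P[A₁(0, n)] ≤ P[A₁(N, n)] ≤ c⁻⁵ᵏ P[A₁(N, n)]`
    have h1 : emb.embArmProb oneArmColour (0 * N) n ≤ emb.embArmProb oneArmColour N n := by
      rw [zero_mul]
      exact emb.embArmProb_inner_mono hiso oneArmColour (Nat.zero_le N)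
        (le_trans (Nat.le_mul_of_pos_left N (pow_pos two_pos _)) hk)
    have h2 : (1 : ℝ) ≤ ((c ^ 5)⁻¹) ^ k := by
      apply one_le_pow₀
      rw [one_le_inv_iff₀]
      exact ⟨by positivity, pow_le_one₀ hc.le (hbxp_le_one emb hbxp hn₀)⟩
    calc emb.embArmProb oneArmColour (0 * N) n ≤ emb.embArmProb oneArmColour N n := h1
      _ = 1 * emb.embArmProb oneArmColour N n := (one_mul _).symm
      _ ≤ ((c ^ 5)⁻¹) ^ k * emb.embArmProb oneArmColour N n := by
          gcongr
          exact emb.embArmProb_nonneg oneArmColour N n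
  · have hmono : emb.embArmProb oneArmColour (m * N) n ≤ emb.embArmProb oneArmColour (2 ^ k * N) n :=
      emb.embArmProb_inner_mono hiso oneArmColour (Nat.mul_le_mul_right N hm)
        (le_trans (Nat.mul_le_mul_right N (Nat.pow_le_pow_right (by norm_num) (Nat.le_succ k))) hk)
    exact hmono.trans (embArmProb_pow_two_inner_le emb hiso hrh hc hbxp hn₀ hN k hk)
where
  /-- the box-crossing constant is at most `1` (it bounds a probability below) -/
  hbxp_le_one {c : ℝ} {n₀ N : ℕ} (emb : RhombicEmbedding G F)
      (hbxp : BoxCrossingBounds emb.isoradialPercolation emb.z 4 c n₀) (hn₀ : n₀ ≤ N) : c ≤ 1 := by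
    have h := ((hbxp N hn₀ 0).1).1
    exact h.trans measureReal_le_one

/-- **Prop. (exp_equiv) (a) for one arm, iterated to an arbitrary factor**: for `1 ≤ m ≤ 2ᵏ`,
`N ≥ n₀ ⊔ 2` and `2N ≤ n`, `P_G[A₁(N, n)] ≤ c⁻¹⁰ᵏ · P_G[A₁(N, m n)]`
(`embArmProb_le_pow_two_outer`, then antitonicity in the outer radius from `2ᵏ n` down to `m n`)
— the shape "`P[A_k(·, c_d⁻¹ n)] ≤ c P[A_k(·, n)]` by (exp_equiv_a), iterated" of GM §8.3.
[cite: GrimmettManolescu2014Isoradial, §8.2 Prop. (exp_equiv) (a) iterated, §8.3] -/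
theorem embArmProb_le_mul_outer [Nonempty F] [Countable V] [DecidableEq V]
    (hiso : emb.IsIsoradial) (hrh : emb.IsRhombicTiling) {c : ℝ} (hc : 0 < c) {n₀ : ℕ}
    (hbxp : BoxCrossingBounds emb.isoradialPercolation emb.z 4 c n₀) {N n : ℕ} (hn₀ : n₀ ≤ N)
    (hN : 2 ≤ N) (hn : 2 * N ≤ n) {m k : ℕ} (hm1 : 1 ≤ m) (hm : m ≤ 2 ^ k) :
    emb.embArmProb oneArmColour N n ≤
      ((c ^ 10)⁻¹) ^ k * emb.embArmProb oneArmColour N (m * n) := by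
  have h1 := embArmProb_le_pow_two_outer emb hiso hrh hc hbxp hn₀ hN hn k
  have h2 : emb.embArmProb oneArmColour N (2 ^ k * n) ≤ emb.embArmProb oneArmColour N (m * n) :=
    emb.embArmProb_outer_anti hiso oneArmColour
      (by nlinarith) (Nat.mul_le_mul_right n hm)
  calc emb.embArmProb oneArmColour N n
      ≤ ((c ^ 10)⁻¹) ^ k * emb.embArmProb oneArmColour N (2 ^ k * n) := h1
    _ ≤ ((c ^ 10)⁻¹) ^ k * emb.embArmProb oneArmColour N (m * n) := by gcongr

/-! ### §3 On the class `𝒢(ε, I)`: uniformity in the centre from the uniform box-crossing fact -/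

/-- **Uniformity of the one-arm probability in the centre, on `𝒢(ε, I)`, from the uniform
box-crossing fact** (Grimmett–Manolescu's Theorem 3.1 in its uniform form,
`gm_boxCrossingBounds_uniform`): for `ε > 0`, `I` and a displacement bound `d` there are `C > 0`
and `N₀` such that for every graph of the class `𝒢(ε, I)` (preconnected, isoradial rhombic
tiling, BAP(ε), SGP(I); vertex type in `Type`), every `a ∈ ℂ` with `‖a‖_∞ ≤ d` and all
`N ≥ N₀`, `n ≥ 5N`:
`P_G[A₁(N, n), centre 0] ≤ C · P_G[A₁(N, n), centre -a]` and
`P_G[A₁(N, n), centre -a] ≤ C · P_G[A₁(N, n), centre 0]` (`C = c(ε, I, 4)⁻¹⁵`, `N₀ = n₀ ⊔ 2 ⊔ d`).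
This is the last paragraph of §8.4 ("any vertex … within bounded distance … extend the
conclusion to arm events centred at any vertex") for `k = 1`, made quantitative, conditional on
the box-crossing Theorem.
[cite: GrimmettManolescu2014Isoradial, §8.4 (last paragraph), §8.1 Prop. (exp_transport) (any vertex u), via §3 Thm 3.1 / (3.1)] -/
theorem oneArm_recentre_of_gm_boxCrossingBounds_uniform (h : gm_boxCrossingBounds_uniform)
    (ε : ℝ) (hε : 0 < ε) (I d : ℕ) :
    ∃ C > (0 : ℝ), ∃ N₀ : ℕ, ∀ (V F : Type) [Countable V] [DecidableEq V] [DecidableEq F]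
      (G : SimpleGraph V) [G.LocallyFinite] (emb : RhombicEmbedding G F),
      G.Preconnected → emb.IsIsoradial → emb.IsRhombicTiling → emb.HasBoundedAngles ε →
      emb.SquareGridPropertyGM I → ∀ a : ℂ, a.boxNorm ≤ d → ∀ N n : ℕ, N₀ ≤ N → 5 * N ≤ n →
        emb.embArmProb oneArmColour N n ≤ C * (emb.translate a).embArmProb oneArmColour N n ∧
          (emb.translate a).embArmProb oneArmColour N n ≤ C * emb.embArmProb oneArmColour N n := by
  obtain ⟨c, hc, n₀, hbxp⟩ := h ε hε I 4 (by norm_num)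
  refine ⟨(c ^ 15)⁻¹, by positivity, max (max n₀ 2) d, ?_⟩
  intro V F _ _ _ G _ emb hconn hiso hrh hbap hsgp a ha N n hN hn
  have hn₀ : n₀ ≤ N := le_trans (le_trans (le_max_left _ _) (le_max_left _ _)) hN
  have hN2 : 2 ≤ N := le_trans (le_trans (le_max_right _ _) (le_max_left _ _)) hN
  have hdN : d ≤ N := le_trans (le_max_right _ _) hN
  rcases isEmpty_or_nonempty F with hF | hF
  · simp [RhombicEmbedding.embArmProb, embArmEvent_oneArm_eq_empty]
  · have hb := hbxp V F G emb hconn hiso hrh hbap hsgp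
    exact ⟨embArmProb_le_translate_mul emb hiso hrh hc hb ha hn₀ hN2 hdN hn,
      embArmProb_translate_le emb hiso hrh hc hb ha hn₀ hN2 hdN hn⟩

end IsoradialArmRecentring

end Literature.Probability.Percolation
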